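import Summits.KontsevichZagierPeriods.Zeta5Search.Barrier.ConeGammaCuspGermKink

/-!
# ζ(5) search — BARRIER: ONE SET FUNCTION — the cusp slope is the Lovász extension of the PERIOD PATTERN FUNCTION

HONEST FRAMING (cell `pub-zeta5`): systematic search; no irrationality claim unless kernel-certified. MODEL objects
under Brown–Zudilin's (28)+(30) accounting ([BZ22] = arXiv:2210.03391; (28) observed, not proved); nothing here is a
statement about `ζ(5)`, any `γ` of record, the cone's supremum (C2 OPEN) or the value / sign of the cusp slope, of its
weights or of the type of the period pattern function at a named direction (DATA of the cell); S-E stays CONJECTURED;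
records in print UNMOVED. Prover P2 g31, item «ONE SET FUNCTION» (INBOX 2026-08-27), file (1); consumes P2 g30's junction
identification (`ConeGammaCuspGermLovasz`) and pure greedy calculus (`ConeGammaCuspGermGreedy`).

SETTING. All 28 forms of `a` positive, `T > 0` a period. For every junction `b_m` (`m + 1 < #bkpts`, the lattice point
`b_0 = 0` included) a finset `M m` and a pattern function `f m` through which the saving factors near `θ_{b_m}`
(`hf`, exactly the hypothesis of `germ_pair_eq_lovasz`), and THE PERIOD PATTERN FUNCTION
`F(A) = Σ_m f m (A ∩ M m)` on ALL subsets `A` of the 28 forms (`hF`; a hypothesis shape, no definition). Rates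
`r_k(δ) = φ_k(δ)/h_k(a)` for all `k < 28`; for `δ₀` GENERIC (all 28 rates pairwise distinct) the prefix sets
`P≤(k) = {l : r_k(δ₀) ≤ r_l(δ₀)}`, `P<(k)` over ALL 28 forms and the GLOBAL GREEDY WEIGHTS `W_k = F(P≤(k)) − F(P<(k))`.
* **`cuspSlope_eq_lovasz_period`** — `σ(δ) = −Σ_i d_i (F(S_i) − F(S_{i−1}))` along any chain through the 28 flip times,
  `S_i = {k : −r_k(δ) ≤ d_i}`: THE CUSP SLOPE IS THE LOVÁSZ EXTENSION (Choquet integral) OF ONE SET FUNCTION ON THE 28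
  FORMS, evaluated at the 28 rates (sum of the junction identities of P2 g30 — the extension is additive in the set
  function and `A ↦ f(A ∩ M)` extends to `f̂(x|_M)`);
* **`cuspSlope_eq_greedy_period_of_refines`** / `_self` — on the closed chamber of a generic `δ₀` (all 28 forms):
  `σ(δ) = Σ_k W_k · r_k(δ)` — P2 g29's chamber weights `𝒥_k` ARE the greedy vector of `F` in the flip order of `δ₀`;
  `exists_generic_greedy_eq_cuspSlope` — every `σ(δ)` is the value of some chamber functional at `δ`;
* `period_weight_eq_sum_junction_weights` — `W_k = Σ_{m : k ∈ M m} (f m (P≤(k) ∩ M m) − f m (P<(k) ∩ M m))` (the junction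
  greedy weights of `germ_pair_eq_greedy_of_refines`, summed over the junctions where `k` is a member);
* `period_pattern_univ_sub_empty` — `F(univ) − F(∅) = 0` (the orbit jumps of one period cancel, P2 g29's
  `sum_orbitJumps_eq_zero`), whence **`period_greedy_sum_eq_zero`**: `Σ_k W_k = 0`.
DESK (DATA, `HOME/pub-zeta5-p2/g31/alg/periodlovasz.py`, exact, on P2 g11's sealed machinery): `Σ_b K_b(δ) = F̂(r(δ))`,
`Σ_k W_k = 0`, `W_k ≥ 0` on `F` / `≤ 0` off `F`, `|W_k| ≤ T·h_k`, `σ(δ₀) = Σ W_k r_k(δ₀)` — 0 failures at record/41, flag/60,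
argmax-120, t*/480. NOT here: the type of `F` anywhere (file (2) takes it as a HYPOTHESIS); `γ`, C2, S-E, `ζ(5)`.
-/

noncomputable section

open Set MeasureTheory Finset
open scoped Topology

namespace Summit.KontsevichZagierPeriods.Zeta5Search.Barrier.ConeGamma

/-! ### Restricting threshold and prefix sets to a member finset -/

/-- `univ.filter p ∩ M = M.filter p` (a threshold / prefix set over all 28 forms, restricted to a member finset). -/
theorem univ_filter_inter_eq (M : Finset (Fin 28)) (p : Fin 28 → Prop) [DecidablePred p] :
    (Finset.univ.filter p) ∩ M = M.filter p := by
  ext k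
  simp only [Finset.mem_filter, Finset.mem_inter, Finset.mem_univ, true_and]
  exact and_comm

/-! ### The cusp slope is the Lovász extension of the period pattern function -/

/-- **THE CUSP SLOPE IS THE LOVÁSZ EXTENSION OF ONE SET FUNCTION.** All 28 forms of `a` positive, `T > 0` a period;
junction data `M m`, `f m` with the agreement hypothesis `hf` at every junction `b_m` (`m + 1 < #bkpts`), and the period
pattern function `F(A) = Σ_m f m (A ∩ M m)`. Then for every displacement `δ` and every weakly increasing chain
`−W = d_0 ≤ ⋯ ≤ d_n = W` through the 28 flip times `−φ_k(δ)/h_k(a)`: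
`cuspSlope a T δ = −Σ_{0<i<n} d_i · (F(S_i) − F(S_{i−1}))`, `S_i = {k : −φ_k(δ)/h_k ≤ d_i}` — the Choquet integral of `F`
at the 28 rates. -/
theorem cuspSlope_eq_lovasz_period {a : Dir} (hpos : ∀ k, 0 < h28 a k) {T : ℝ} (hT : 0 < T)
    (hper : ∀ k : Fin 28, ∃ z : ℤ, T * h28 a k = z)
    {M : ℕ → Finset (Fin 28)} {f : ℕ → Finset (Fin 28) → ℝ}
    (hf : ∀ m, m + 1 < (bkpts a T).card → ∀ Δ : Fin 8 → ℝ, (∀ k, |phiForm Δ k| < 1) →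
      (∀ k, |phiForm Δ k| < wallDist a T) →
        (torusN (bkpt a T m • sParam a + Δ) : ℝ) = f m ((M m).filter fun k => 0 ≤ phiForm Δ k))
    {F : Finset (Fin 28) → ℝ} (hF : ∀ A, F A = ∑ m ∈ Finset.range ((bkpts a T).card - 1), f m (A ∩ M m))
    (δ : Fin 8 → ℝ) {n : ℕ} {d : ℕ → ℝ} (hd0 : d 0 = -clusterWidth a δ) (hdn : d n = clusterWidth a δ)
    (hmono : ∀ j < n, d j ≤ d (j + 1)) (hflip : ∀ k, ∃ i ≤ n, d i = -(phiForm δ k / h28 a k)) :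
    cuspSlope a T δ =
      -∑ i ∈ Finset.Ico 1 n, d i *
        (F (Finset.univ.filter fun k => -(phiForm δ k / h28 a k) ≤ d i) -
          F (Finset.univ.filter fun k => -(phiForm δ k / h28 a k) ≤ d (i - 1))) := by
  classical
  obtain ⟨ρ, hρ, h1, h2, hgap⟩ := exists_admissible_scale hpos hT δ
  rw [cuspSlope_eq_sum_germ_pairs hpos hT hper δ hρ h1 h2 hgap]
  have hterm : ∀ m ∈ Finset.range ((bkpts a T).card - 1),
      germR a δ ρ (bkpt a T m) + germL a δ ρ (bkpt a T m) =
        -∑ i ∈ Finset.Ico 1 n, d i *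
          (f m ((Finset.univ.filter fun k => -(phiForm δ k / h28 a k) ≤ d i) ∩ M m) -
            f m ((Finset.univ.filter fun k => -(phiForm δ k / h28 a k) ≤ d (i - 1)) ∩ M m)) := by
    intro m hm
    have hm' : m + 1 < (bkpts a T).card := by have := Finset.mem_range.mp hm; omega
    rw [germ_pair_eq_lovasz hpos (bkpt_mem (by omega)) (hf m hm') δ hρ h1 h2 hd0 hdn hmono (fun k _ => hflip k)]
    simp only [univ_filter_inter_eq]
  rw [Finset.sum_congr rfl hterm]
  simp only [hF, ← Finset.sum_sub_distrib, Finset.mul_sum, ← Finset.sum_neg_distrib]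
  rw [Finset.sum_comm]

/-! ### The closed chamber of a generic reference: global greedy weights -/

/-- **ON THE CLOSED CHAMBER THE CUSP SLOPE IS THE GLOBAL GREEDY FUNCTIONAL.** With the data of
`cuspSlope_eq_lovasz_period`: if the 28 rates of `δ₀` are pairwise distinct and `δ` is refined by `δ₀`
(`r_k(δ) < r_l(δ) ⇒ r_k(δ₀) < r_l(δ₀)`), then
`cuspSlope a T δ = Σ_k (F(P≤(k)) − F(P<(k))) · φ_k(δ)/h_k(a)`, `P≤(k) = {l : r_k(δ₀) ≤ r_l(δ₀)}`,
`P<(k) = {l : r_k(δ₀) < r_l(δ₀)}` (all 28 forms) — P2 g29's chamber weights are the greedy vector of `F`. -/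
theorem cuspSlope_eq_greedy_period_of_refines {a : Dir} (hpos : ∀ k, 0 < h28 a k) {T : ℝ} (hT : 0 < T)
    (hper : ∀ k : Fin 28, ∃ z : ℤ, T * h28 a k = z)
    {M : ℕ → Finset (Fin 28)} {f : ℕ → Finset (Fin 28) → ℝ}
    (hf : ∀ m, m + 1 < (bkpts a T).card → ∀ Δ : Fin 8 → ℝ, (∀ k, |phiForm Δ k| < 1) →
      (∀ k, |phiForm Δ k| < wallDist a T) →
        (torusN (bkpt a T m • sParam a + Δ) : ℝ) = f m ((M m).filter fun k => 0 ≤ phiForm Δ k))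
    {F : Finset (Fin 28) → ℝ} (hF : ∀ A, F A = ∑ m ∈ Finset.range ((bkpts a T).card - 1), f m (A ∩ M m))
    {δ₀ : Fin 8 → ℝ} (hgen : ∀ k l : Fin 28, k ≠ l → phiForm δ₀ k / h28 a k ≠ phiForm δ₀ l / h28 a l)
    (δ : Fin 8 → ℝ) (href : ∀ k l : Fin 28, phiForm δ k / h28 a k < phiForm δ l / h28 a l →
      phiForm δ₀ k / h28 a k < phiForm δ₀ l / h28 a l) :
    cuspSlope a T δ =
      ∑ k, (F (Finset.univ.filter fun l => phiForm δ₀ k / h28 a k ≤ phiForm δ₀ l / h28 a l) -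
          F (Finset.univ.filter fun l => phiForm δ₀ k / h28 a k < phiForm δ₀ l / h28 a l)) *
        (phiForm δ k / h28 a k) := by
  classical
  obtain ⟨n, d, hd0, hdn, hmono, hflip, hflipM⟩ := exists_member_chain hpos 0 Finset.univ δ
  have hflip' : ∀ k, ∃ i ≤ n, d i = -(phiForm δ k / h28 a k) := fun k => hflip k ⟨0, by simp⟩
  rw [cuspSlope_eq_lovasz_period hpos hT hper hf hF δ hd0 hdn (fun j hj => (hmono j hj).le) hflip']
  have hgen' : ∀ k ∈ (Finset.univ : Finset (Fin 28)), ∀ l ∈ (Finset.univ : Finset (Fin 28)), k ≠ l →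
      phiForm δ₀ k / h28 a k ≠ phiForm δ₀ l / h28 a l := fun k _ l _ hkl => hgen k l hkl
  have key := greedy_eq_lovasz_of_prefix (M := Finset.univ) (ρ := fun k => phiForm δ₀ k / h28 a k) F hgen'
    (fun k => -(phiForm δ k / h28 a k)) hmono hflipM ?_
  · rw [← key]
    exact Finset.sum_congr rfl fun k _ => by rw [neg_neg]
  -- every threshold set of `δ` is empty or a prefix set of `δ₀`
  intro i _
  rcases (Finset.univ.filter fun k : Fin 28 => -(phiForm δ k / h28 a k) ≤ d i).eq_empty_or_nonempty with h | hne
  · exact Or.inl h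
  · right
    obtain ⟨t, ht, hmin⟩ := Finset.exists_min_image _ (fun k => phiForm δ₀ k / h28 a k) hne
    obtain ⟨-, htc⟩ := Finset.mem_filter.mp ht
    refine ⟨t, Finset.mem_univ _, ?_⟩
    ext k
    simp only [Finset.mem_filter, Finset.mem_univ, true_and]
    constructor
    · intro hk; exact hmin k (Finset.mem_filter.mpr ⟨Finset.mem_univ _, hk⟩)
    · intro hle
      by_contra hkc
      have hlt : phiForm δ k / h28 a k < phiForm δ t / h28 a t := by have := not_le.mp hkc; linarith
      exact absurd (href k t hlt) (not_lt.mpr hle)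

/-- The instance `δ = δ₀`: for a generic `δ₀`, `σ(δ₀) = Σ_k W_k · φ_k(δ₀)/h_k(a)`. -/
theorem cuspSlope_eq_greedy_period_self {a : Dir} (hpos : ∀ k, 0 < h28 a k) {T : ℝ} (hT : 0 < T)
    (hper : ∀ k : Fin 28, ∃ z : ℤ, T * h28 a k = z)
    {M : ℕ → Finset (Fin 28)} {f : ℕ → Finset (Fin 28) → ℝ}
    (hf : ∀ m, m + 1 < (bkpts a T).card → ∀ Δ : Fin 8 → ℝ, (∀ k, |phiForm Δ k| < 1) →
      (∀ k, |phiForm Δ k| < wallDist a T) →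
        (torusN (bkpt a T m • sParam a + Δ) : ℝ) = f m ((M m).filter fun k => 0 ≤ phiForm Δ k))
    {F : Finset (Fin 28) → ℝ} (hF : ∀ A, F A = ∑ m ∈ Finset.range ((bkpts a T).card - 1), f m (A ∩ M m))
    {δ₀ : Fin 8 → ℝ} (hgen : ∀ k l : Fin 28, k ≠ l → phiForm δ₀ k / h28 a k ≠ phiForm δ₀ l / h28 a l) :
    cuspSlope a T δ₀ =
      ∑ k, (F (Finset.univ.filter fun l => phiForm δ₀ k / h28 a k ≤ phiForm δ₀ l / h28 a l) -
          F (Finset.univ.filter fun l => phiForm δ₀ k / h28 a k < phiForm δ₀ l / h28 a l)) *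
        (phiForm δ₀ k / h28 a k) :=
  cuspSlope_eq_greedy_period_of_refines hpos hT hper hf hF hgen δ₀ (refines_refl a δ₀)

/-- **EVERY SLOPE IS A CHAMBER VALUE.** For every `δ` there is a generic `δ₀` refining `δ` (P2 g30's cover), so
`cuspSlope a T δ = Σ_k W_k(δ₀) · φ_k(δ)/h_k(a)` for the greedy weights of `F` in the flip order of `δ₀`. -/
theorem exists_generic_greedy_eq_cuspSlope {a : Dir} (hpos : ∀ k, 0 < h28 a k) {T : ℝ} (hT : 0 < T)
    (hper : ∀ k : Fin 28, ∃ z : ℤ, T * h28 a k = z)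
    {M : ℕ → Finset (Fin 28)} {f : ℕ → Finset (Fin 28) → ℝ}
    (hf : ∀ m, m + 1 < (bkpts a T).card → ∀ Δ : Fin 8 → ℝ, (∀ k, |phiForm Δ k| < 1) →
      (∀ k, |phiForm Δ k| < wallDist a T) →
        (torusN (bkpt a T m • sParam a + Δ) : ℝ) = f m ((M m).filter fun k => 0 ≤ phiForm Δ k))
    {F : Finset (Fin 28) → ℝ} (hF : ∀ A, F A = ∑ m ∈ Finset.range ((bkpts a T).card - 1), f m (A ∩ M m))
    (δ : Fin 8 → ℝ) :
    ∃ δ₀ : Fin 8 → ℝ, (∀ k l : Fin 28, k ≠ l → phiForm δ₀ k / h28 a k ≠ phiForm δ₀ l / h28 a l) ∧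
      (∀ k l : Fin 28, phiForm δ k / h28 a k < phiForm δ l / h28 a l →
        phiForm δ₀ k / h28 a k < phiForm δ₀ l / h28 a l) ∧
      cuspSlope a T δ =
        ∑ k, (F (Finset.univ.filter fun l => phiForm δ₀ k / h28 a k ≤ phiForm δ₀ l / h28 a l) -
            F (Finset.univ.filter fun l => phiForm δ₀ k / h28 a k < phiForm δ₀ l / h28 a l)) *
          (phiForm δ k / h28 a k) := by
  obtain ⟨δ₀, hgen, href⟩ := exists_generic_refines hpos δ
  exact ⟨δ₀, hgen, href, cuspSlope_eq_greedy_period_of_refines hpos hT hper hf hF hgen δ href⟩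

/-! ### The global weights are sums of junction weights; they add up to zero -/

/-- **GLOBAL WEIGHT = SUM OF THE JUNCTION WEIGHTS.** For rates `ρ` pairwise distinct on all 28 forms and every `k`:
`F(P≤(k)) − F(P<(k)) = Σ_{m : k ∈ M m} (f m ((M m).filter (ρ k ≤ ρ ·)) − f m ((M m).filter (ρ k < ρ ·)))` — the greedy
weight of `F` at `k` is the sum, over the junctions where `k` is a member, of their own greedy weights (the junctions
where `k` is not a member contribute `0`: their two prefix patterns coincide). Pure set-function algebra (`hF` only). -/
theorem period_weight_eq_sum_junction_weights {N : ℕ} {M : ℕ → Finset (Fin 28)} {f : ℕ → Finset (Fin 28) → ℝ}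
    {F : Finset (Fin 28) → ℝ} (hF : ∀ A, F A = ∑ m ∈ Finset.range N, f m (A ∩ M m))
    {ρ : Fin 28 → ℝ} (hgen : ∀ k l : Fin 28, k ≠ l → ρ k ≠ ρ l) (k : Fin 28) :
    F (Finset.univ.filter fun l => ρ k ≤ ρ l) - F (Finset.univ.filter fun l => ρ k < ρ l) =
      ∑ m ∈ (Finset.range N).filter (fun m => k ∈ M m),
        (f m ((M m).filter fun l => ρ k ≤ ρ l) - f m ((M m).filter fun l => ρ k < ρ l)) := by
  classical
  rw [hF, hF, ← Finset.sum_sub_distrib, Finset.sum_filter]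
  refine Finset.sum_congr rfl fun m _ => ?_
  rw [univ_filter_inter_eq, univ_filter_inter_eq]
  split_ifs with hk
  · rfl
  · -- `k ∉ M m`: the two prefix patterns of junction `m` coincide
    have : (M m).filter (fun l => ρ k ≤ ρ l) = (M m).filter fun l => ρ k < ρ l := by
      refine Finset.filter_congr fun l hl => ⟨fun hle => lt_of_le_of_ne hle (hgen k l ?_), le_of_lt⟩
      rintro rfl; exact hk hl
    rw [this, sub_self]

/-- **THE ORBIT JUMPS CANCEL: `F(univ) − F(∅) = 0`.** With the junction data of one period (`hf` at every junction) and
`F(A) = Σ_m f m (A ∩ M m)`: `F` takes the same value on all 28 forms and on none (`f m (M m) − f m ∅` is the jump of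
the saving across the junction `b_m` along the orbit; the jumps of one period add up to `0`, `sum_orbitJumps_eq_zero`). -/
theorem period_pattern_univ_sub_empty {a : Dir} (hpos : ∀ k, 0 < h28 a k) {T : ℝ} (hT : 0 < T)
    (hper : ∀ k : Fin 28, ∃ z : ℤ, T * h28 a k = z)
    {M : ℕ → Finset (Fin 28)} {f : ℕ → Finset (Fin 28) → ℝ}
    (hf : ∀ m, m + 1 < (bkpts a T).card → ∀ Δ : Fin 8 → ℝ, (∀ k, |phiForm Δ k| < 1) →
      (∀ k, |phiForm Δ k| < wallDist a T) →
        (torusN (bkpt a T m • sParam a + Δ) : ℝ) = f m ((M m).filter fun k => 0 ≤ phiForm Δ k))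
    {F : Finset (Fin 28) → ℝ} (hF : ∀ A, F A = ∑ m ∈ Finset.range ((bkpts a T).card - 1), f m (A ∩ M m)) :
    F Finset.univ - F ∅ = 0 := by
  classical
  -- a small step along the orbit realises the patterns `M m` (all members up) and `∅` (all members down)
  have hX := xMax_pos hpos
  have hd := wallDist_pos a T
  set τ : ℝ := min 1 (wallDist a T) / (2 * xMax a) with hτ
  have hτpos : 0 < τ := div_pos (lt_min one_pos hd) (by positivity)
  have hτX : τ * xMax a = min 1 (wallDist a T) / 2 := by rw [hτ]; field_simp
  have hτ1 : τ * xMax a < 1 := by rw [hτX]; linarith [min_le_left (1 : ℝ) (wallDist a T)]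
  have hτ2 : τ * xMax a < wallDist a T := by rw [hτX]; linarith [min_le_right (1 : ℝ) (wallDist a T)]
  have hsmall : ∀ k, |phiForm (τ • sParam a) k| < 1 ∧ |phiForm (τ • sParam a) k| < wallDist a T := fun k => by
    rw [phiForm_smul_sParam, abs_of_pos (mul_pos hτpos (hpos k))]
    have hle : τ * h28 a k ≤ τ * xMax a := mul_le_mul_of_nonneg_left (le_xMax a k) hτpos.le
    exact ⟨hle.trans_lt hτ1, hle.trans_lt hτ2⟩
  have hup : ∀ m, m + 1 < (bkpts a T).card →
      (torusN (bkpt a T m • sParam a + τ • sParam a) : ℝ) = f m (M m) := fun m hm => by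
    rw [hf m hm _ (fun k => (hsmall k).1) (fun k => (hsmall k).2)]
    congr 1
    refine Finset.filter_true_of_mem fun k _ => ?_
    rw [phiForm_smul_sParam]; exact (mul_pos hτpos (hpos k)).le
  have hdown : ∀ m, m + 1 < (bkpts a T).card →
      (torusN (bkpt a T m • sParam a - τ • sParam a) : ℝ) = f m ∅ := fun m hm => by
    rw [sub_eq_add_neg, hf m hm _ (fun k => by rw [phiForm_neg, abs_neg]; exact (hsmall k).1)
      (fun k => by rw [phiForm_neg, abs_neg]; exact (hsmall k).2)]
    congr 1
    refine Finset.filter_false_of_mem fun k _ => ?_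
    rw [phiForm_neg, phiForm_smul_sParam, not_le, neg_lt_zero]; exact mul_pos hτpos (hpos k)
  have hJ := sum_orbitJumps_eq_zero hpos hT hper hτpos hτ1 hτ2
  rw [Finset.sum_congr rfl fun m hm => by
    rw [hup m (by have := Finset.mem_range.mp hm; omega), hdown m (by have := Finset.mem_range.mp hm; omega)],
    Finset.sum_sub_distrib] at hJ
  rw [hF, hF]
  simpa only [Finset.univ_inter, Finset.empty_inter] using hJ

/-- **THE GLOBAL GREEDY WEIGHTS ADD UP TO ZERO**: `Σ_k (F(P≤(k)) − F(P<(k))) = 0` for every generic `δ₀`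
(telescoping `greedy_sum_eq` + `period_pattern_univ_sub_empty`; P2 g29's `Σ_k 𝒥_k = 0`). -/
theorem period_greedy_sum_eq_zero {a : Dir} (hpos : ∀ k, 0 < h28 a k) {T : ℝ} (hT : 0 < T)
    (hper : ∀ k : Fin 28, ∃ z : ℤ, T * h28 a k = z)
    {M : ℕ → Finset (Fin 28)} {f : ℕ → Finset (Fin 28) → ℝ}
    (hf : ∀ m, m + 1 < (bkpts a T).card → ∀ Δ : Fin 8 → ℝ, (∀ k, |phiForm Δ k| < 1) →
      (∀ k, |phiForm Δ k| < wallDist a T) →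
        (torusN (bkpt a T m • sParam a + Δ) : ℝ) = f m ((M m).filter fun k => 0 ≤ phiForm Δ k))
    {F : Finset (Fin 28) → ℝ} (hF : ∀ A, F A = ∑ m ∈ Finset.range ((bkpts a T).card - 1), f m (A ∩ M m))
    {δ₀ : Fin 8 → ℝ} (hgen : ∀ k l : Fin 28, k ≠ l → phiForm δ₀ k / h28 a k ≠ phiForm δ₀ l / h28 a l) :
    ∑ k, (F (Finset.univ.filter fun l => phiForm δ₀ k / h28 a k ≤ phiForm δ₀ l / h28 a l) -
        F (Finset.univ.filter fun l => phiForm δ₀ k / h28 a k < phiForm δ₀ l / h28 a l)) = 0 := by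
  have hgen' : ∀ k ∈ (Finset.univ : Finset (Fin 28)), ∀ l ∈ (Finset.univ : Finset (Fin 28)), k ≠ l →
      phiForm δ₀ k / h28 a k ≠ phiForm δ₀ l / h28 a l := fun k _ l _ hkl => hgen k l hkl
  rw [greedy_sum_eq (M := Finset.univ) (ρ := fun k => phiForm δ₀ k / h28 a k) F hgen',
    period_pattern_univ_sub_empty hpos hT hper hf hF]

end Summit.KontsevichZagierPeriods.Zeta5Search.Barrier.ConeGamma

end
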